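import Literature.Analysis.FluidPDE.OseenAncientKatoClass
import Literature.Analysis.FluidPDE.KatoL3Uniqueness
import HarnessLib

/-!
# `Lᵖ` slices propagate along bounded Oseen-mild solutions on a time window (`1 ≤ p < ∞`)

Analysis/FluidPDE proof file (theorems only: no definition, no named fact, no `sorry`) on the
discharge path of the named fact
`Literature.Analysis.FluidPDE.AlbrittonBarker2019_liouville_weakL3_backward`
(`AncientL3BackwardLiouville.lean`; Albritton–Barker, arXiv:1811.00502, **Thm. 4.1**). The sibling
file `OseenAncientLpPropagation.lean` proves the propagation of `Lᵖ` slices along **ancient**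
bounded solutions of the Oseen integral equation (hypotheses on `(−∞, 0) × ℝ³`). The blow-down
sequence of the proof of Thm. 4.1 is handed over (hypothesis `H` of
`AlbrittonBarker2019_liouville_weakL3_backward_of_blowdown`) as **forward** solutions on a closed
window `[0, S]`; this file is the window version of the same argument (Lemarié-Rieusset 2016,
§9.9 and proof of Thm. 9.12, PDF p. 260: Oseen's Picard scheme for bounded `Lᵖ ∩ L^∞` data,
`exists_oseen_fixedPoint_bounded`, and uniqueness of bounded solutions of the integral equation,
`oseenMild_bounded_unique`), for a field continuous and bounded on `[a, b] × ℝ³` satisfying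
`v(t) = e^{(t−s)Δ}v(s) − B¹_s(v, v)(t)` pointwise for `a ≤ s < t ≤ b`:

* `oseenWindow_local_exponent` — the local step from any `τ ∈ [a, b)` with `v(τ) ∈ Lᵖ`:
  `‖v(τ + t)‖_p ≤ 2‖v(τ)‖_p` and `v(τ + t) ∈ Lᵖ` on `[0, min(T₀(K), b − τ))`;
* `oseenWindow_memLp_eLpNorm_le_two_pow` — propagation with the doubling bound
  `‖v(t)‖_p ≤ 2ⁿ ‖v(a)‖_p` for `t ≤ a + n T₀/2`, `t < b`;
* `oseenWindow_exists_forall_memLp_eLpNorm_le` — hence `v(t) ∈ Lᵖ` with `‖v(t)‖_p ≤ B` for all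
  `t ∈ [a, b]` (the endpoint `b` by Fatou along `t ↑ b`, the slices converging pointwise).

## References

* P. G. Lemarié-Rieusset, *The Navier–Stokes Problem in the 21st Century* (CRC 2016), §9.9 and
  proof of Thm. 9.12 (PDF p. 260). [`LemarieRieusset2016`]
* G. Koch, N. Nadirashvili, G. Seregin, V. Šverák, Acta Math. 203 (2009) = arXiv:0709.3599, §4
  (4.3)–(4.4). [`KochNadirashviliSereginSverak2009`]
* D. Albritton, T. Barker, arXiv:1811.00502, proof of Thm. 4.1 (p. 9). [`AlbrittonBarker2019`]
-/

noncomputable section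

open MeasureTheory TopologicalSpace Set Function Filter Metric
open _root_.Topology
open scoped ENNReal NNReal RealInnerProductSpace

namespace Literature.Analysis.FluidPDE

variable {v : ℝ → EuclideanSpace ℝ (Fin 3) → EuclideanSpace ℝ (Fin 3)} {K a b : ℝ} {p : ℝ≥0∞}

/-! ### Measurability of translates on a window -/

/-- The translate `t ↦ v(τ + t)` of a field continuous on `[a, b] × ℝ³` is measurable on the
slab `(0, T) × ℝ³` whenever `a ≤ τ` and `τ + T ≤ b`. [folklore] -/
theorem aestronglyMeasurable_uncurry_translate_of_continuousOn_Icc_slab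
    (hcont : ContinuousOn (uncurry v) (Icc a b ×ˢ univ)) {τ T : ℝ} (haτ : a ≤ τ) (hT : τ + T ≤ b) :
    AEStronglyMeasurable (uncurry fun t => v (τ + t))
      ((volume : Measure (ℝ × EuclideanSpace ℝ (Fin 3))).restrict (Ioo 0 T ×ˢ univ)) := by
  have hc : ContinuousOn (uncurry fun t => v (τ + t)) (Ioo 0 T ×ˢ (univ : Set (EuclideanSpace ℝ (Fin 3)))) := by
    have e : (uncurry fun t => v (τ + t)) = uncurry v ∘ fun z : ℝ × EuclideanSpace ℝ (Fin 3) => (τ + z.1, z.2) := by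
      funext ⟨t, x⟩; rfl
    rw [e]
    refine hcont.comp (by fun_prop) fun z hz => ⟨⟨?_, ?_⟩, mem_univ _⟩
    · show a ≤ τ + z.1
      linarith [hz.1.1]
    · show τ + z.1 ≤ b
      linarith [hz.1.2]
  exact hc.aestronglyMeasurable (measurableSet_Ioo.prod MeasurableSet.univ)

/-! ### The local step -/

/-- **The local step of the `Lᵖ` propagation on a window, `1 ≤ p < ∞`** (Lemarié-Rieusset 2016,
§9.9 and proof of Thm. 9.12, PDF p. 260; KNSS 2009, §4 (4.3)–(4.4)). Let `v` be continuous and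
bounded by `K` on `[a, b] × ℝ³` and satisfy the Oseen integral equation
`v(t) = e^{(t−s)Δ}v(s) − B¹_s(v, v)(t)` pointwise for all `a ≤ s < t ≤ b`. There is `T₀ > 0`,
depending only on `K`, such that for every `τ ∈ [a, b)` with `v(τ) ∈ Lᵖ` and every
`t ∈ [0, min(T₀, b − τ))`: `v(τ + t) ∈ Lᵖ` and `‖v(τ + t)‖_p ≤ 2‖v(τ)‖_p` (Oseen's scheme from
the bounded `Lᵖ` datum `v(τ)` has a fixed point of size `≤ 2‖v(τ)‖_p`, which agrees a.e. at every
time with the translate of `v` by the uniqueness of bounded solutions of the integral equation).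
[cite: LemarieRieusset2016, §9.9 and proof of Thm. 9.12 (PDF p. 260)] [cite: KochNadirashviliSereginSverak2009, §4 (4.3)–(4.4) (arXiv:0709.3599 p. 8)] -/
theorem oseenWindow_local_exponent (hp1 : 1 ≤ p) (hp : p ≠ ∞)
    (hcont : ContinuousOn (uncurry v) (Icc a b ×ˢ univ))
    (hK : ∀ t ∈ Icc a b, ∀ x, ‖v t x‖ ≤ K)
    (hmild : ∀ s t : ℝ, a ≤ s → s < t → t ≤ b → ∀ x,
      v t x = UnboundedOperators.heatExtension (v s) (t - s) x - oseenDuhamel 1 s v v t x) :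
    ∃ T₀ : ℝ, 0 < T₀ ∧ ∀ ⦃τ : ℝ⦄, a ≤ τ → τ < b → MemLp (v τ) p volume →
      ∀ t ∈ Ico 0 (min T₀ (b - τ)), MemLp (v (τ + t)) p volume ∧
        eLpNorm (v (τ + t)) p volume ≤ 2 * eLpNorm (v τ) p volume := by
  obtain ⟨C, hC, hscheme⟩ :=
    exists_oseen_fixedPoint_bounded (E := EuclideanSpace ℝ (Fin 3)) (p := p) hp1 hp
  -- the bound `A = max K 1 > 0` and the lifespan `T₀ = ((16 C)⁻¹ / A)²`
  set A : ℝ := max K 1 with hA_def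
  have hA : 0 < A := lt_max_of_lt_right one_pos
  have hKA : K ≤ A := le_max_left _ _
  set T₀ : ℝ := ((16 * C)⁻¹ / A) ^ 2 with hT₀_def
  have hT₀ : 0 < T₀ := by positivity
  refine ⟨T₀, hT₀, fun τ haτ hτb h3 t ht => ?_⟩
  set T : ℝ := min T₀ (b - τ) with hT_def
  have hT : 0 < T := lt_min hT₀ (sub_pos.2 hτb)
  have hTT₀ : T ≤ T₀ := min_le_left _ _
  have hTτ : τ + T ≤ b := by have := min_le_right T₀ (b - τ); linarith
  -- the smallness condition of Oseen's scheme on `(0, T)`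
  have hsmall : C * A * (1 : ℝ) ^ (-(1 / 2 : ℝ)) * (2 * Real.sqrt T) ≤ 1 / 8 := by
    rw [Real.one_rpow, mul_one]
    have h1 : Real.sqrt T ≤ (16 * C)⁻¹ / A := by
      rw [Real.sqrt_le_left (by positivity)]
      exact hTT₀
    calc C * A * (2 * Real.sqrt T) ≤ C * A * (2 * ((16 * C)⁻¹ / A)) := by gcongr
      _ = 1 / 8 := by field_simp; norm_num
  -- the datum `v τ`: continuous, bounded by `A`, in `Lᵖ`
  have hτI : τ ∈ Icc a b := ⟨haτ, hτb.le⟩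
  have hbc : Continuous (v τ) :=
    hcont.comp_continuous (f := fun x : EuclideanSpace ℝ (Fin 3) => (τ, x)) (by fun_prop)
      fun _ => ⟨hτI, mem_univ _⟩
  have hbm : AEStronglyMeasurable (v τ) volume := hbc.aestronglyMeasurable
  have hbA : ∀ x, ‖v τ x‖ ≤ A := fun x => (hK τ hτI x).trans hKA
  -- Oseen's scheme
  obtain ⟨u, hum, hubd, hu3, -, hfix⟩ := hscheme one_pos hT hA hbm hbA h3 hsmall
  have hA2 : (0 : ℝ) ≤ 2 * A := by positivity
  -- the translate `w t = v (τ + t)` solves the same integral equation on `(0, T)`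
  set w : ℝ → EuclideanSpace ℝ (Fin 3) → EuclideanSpace ℝ (Fin 3) := fun t => v (τ + t) with hw_def
  have hw_apply : ∀ t x, w t x = v (τ + t) x := fun t x => rfl
  have hw_apply' : ∀ t, w t = v (τ + t) := fun t => rfl
  have hwm : AEStronglyMeasurable (uncurry w)
      ((volume : Measure (ℝ × EuclideanSpace ℝ (Fin 3))).restrict (Ioo 0 T ×ˢ univ)) :=
    aestronglyMeasurable_uncurry_translate_of_continuousOn_Icc_slab hcont haτ hTτ
  have hwbd : ∀ t ∈ Ioo 0 T, ∀ x, ‖w t x‖ ≤ 2 * A := by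
    intro t ht x
    rw [hw_apply]
    have hmem : τ + t ∈ Icc a b := ⟨by linarith [ht.1], by linarith [ht.2]⟩
    exact ((hK _ hmem x).trans hKA).trans (by linarith)
  have hwfix : ∀ t ∈ Ioo 0 T, ∀ x,
      w t x = UnboundedOperators.heatExtension (v τ) (1 * t) x - oseenDuhamel 1 0 w w t x := by
    intro t ht x
    have h1 := hmild τ (τ + t) haτ (by linarith [ht.1]) (by linarith [ht.2]) x
    have e1 : τ + t - τ = 1 * t := by ring
    have e2 : oseenDuhamel 1 0 w w t x = oseenDuhamel 1 τ v v (τ + t) x := by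
      have ew : w = fun σ => v (σ + τ) := funext fun σ => by rw [hw_def, add_comm]
      rw [ew, oseenDuhamel_translate 1 0 τ v v t x, zero_add, add_comm t τ]
    rw [e2, hw_apply, ← e1]
    exact h1
  -- uniqueness of bounded solutions of the integral equation
  have hae : ∀ t ∈ Ioo 0 T, u t =ᵐ[volume] w t :=
    oseenMild_bounded_unique (U := fun t x => UnboundedOperators.heatExtension (v τ) (1 * t) x)
      one_pos hA2 hum hwm hubd hwbd (fun t ht => Eventually.of_forall (hfix t ht))
      (fun t ht => Eventually.of_forall (hwfix t ht))
  -- the bound on the window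
  rcases ht.1.eq_or_lt with h | h
  · subst h
    rw [add_zero]
    refine ⟨h3, ?_⟩
    calc eLpNorm (v τ) p volume = 1 * eLpNorm (v τ) p volume := (one_mul _).symm
      _ ≤ 2 * eLpNorm (v τ) p volume := mul_le_mul' (by norm_num) le_rfl
  · have htI : t ∈ Ioo 0 T := ⟨h, ht.2⟩
    have hmemu : MemLp (u t) p volume := by
      have htc : Continuous (v (τ + t)) :=
        hcont.comp_continuous (f := fun x : EuclideanSpace ℝ (Fin 3) => (τ + t, x)) (by fun_prop)
          fun _ => ⟨⟨by linarith, by linarith [ht.2]⟩, mem_univ _⟩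
      refine ⟨(htc.aestronglyMeasurable).congr (hae t htI).symm, ?_⟩
      exact lt_of_le_of_lt (hu3 t htI) (ENNReal.mul_lt_top ENNReal.ofNat_lt_top h3.eLpNorm_lt_top)
    rw [← hw_apply' t]
    refine ⟨(memLp_congr_ae (hae t htI)).1 hmemu, ?_⟩
    rw [← eLpNorm_congr_ae (hae t htI)]
    exact hu3 t htI

/-! ### Propagation with the doubling bound -/

/-- **Propagation of the `Lᵖ` norm along a bounded Oseen-mild solution on a window, with the
doubling bound**: if `v(a) ∈ Lᵖ` then for every `n` and every `t ∈ [a, b)` with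
`t ≤ a + n T₀/2`, `v(t) ∈ Lᵖ` and `‖v(t)‖_p ≤ 2ⁿ ‖v(a)‖_p` (finitely many local steps of the
uniform length `T₀(K)/2`; Lemarié-Rieusset 2016, §9.9, PDF p. 260). [cite: LemarieRieusset2016, §9.9 (PDF p. 260)] -/
theorem oseenWindow_memLp_eLpNorm_le_two_pow (hp1 : 1 ≤ p) (hp : p ≠ ∞)
    (hcont : ContinuousOn (uncurry v) (Icc a b ×ˢ univ))
    (hK : ∀ t ∈ Icc a b, ∀ x, ‖v t x‖ ≤ K)
    (hmild : ∀ s t : ℝ, a ≤ s → s < t → t ≤ b → ∀ x,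
      v t x = UnboundedOperators.heatExtension (v s) (t - s) x - oseenDuhamel 1 s v v t x)
    (h3 : MemLp (v a) p volume) :
    ∃ T₀ : ℝ, 0 < T₀ ∧ ∀ n : ℕ, ∀ t : ℝ, a ≤ t → t < b → t ≤ a + n * (T₀ / 2) →
      MemLp (v t) p volume ∧ eLpNorm (v t) p volume ≤ 2 ^ n * eLpNorm (v a) p volume := by
  obtain ⟨T₀, hT₀, hloc⟩ := oseenWindow_local_exponent hp1 hp hcont hK hmild
  refine ⟨T₀, hT₀, fun n => ?_⟩
  induction n with
  | zero =>
    intro t hat htb htn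
    have e : t = a := le_antisymm (by simpa using htn) hat
    rw [e, pow_zero, one_mul]
    exact ⟨h3, le_rfl⟩
  | succ n ih =>
    intro t hat htb htn
    -- the restart time `t₁ = max a (t - T₀/2)`
    set t₁ : ℝ := max a (t - T₀ / 2) with ht₁
    have hat₁ : a ≤ t₁ := le_max_left _ _
    have ht₁t : t₁ ≤ t := max_le hat (by linarith)
    have ht₁b : t₁ < b := ht₁t.trans_lt htb
    have ht₁n : t₁ ≤ a + n * (T₀ / 2) := by
      refine max_le ?_ ?_
      · have : (0 : ℝ) ≤ n * (T₀ / 2) := by positivity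
        linarith
      · push_cast at htn
        linarith
    obtain ⟨h3₁, hb₁⟩ := ih t₁ hat₁ ht₁b ht₁n
    have hgap : t - t₁ ≤ T₀ / 2 := by
      have : t - T₀ / 2 ≤ t₁ := le_max_right _ _
      linarith
    have hmem : t - t₁ ∈ Ico 0 (min T₀ (b - t₁)) :=
      ⟨sub_nonneg.2 ht₁t, lt_min (by linarith) (by linarith)⟩
    obtain ⟨hm, hb⟩ := hloc hat₁ ht₁b h3₁ (t - t₁) hmem
    have e : t₁ + (t - t₁) = t := by ring
    rw [e] at hm hb
    refine ⟨hm, hb.trans ?_⟩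
    rw [pow_succ, mul_comm ((2 : ℝ≥0∞) ^ n) 2, mul_assoc]
    exact mul_le_mul' le_rfl hb₁

/-! ### Uniform bounds on the closed window -/

/-- **`Lᵖ` slices propagate along a bounded Oseen-mild solution on a closed window, with a
uniform bound**: if `v(a) ∈ Lᵖ`, then `v(t) ∈ Lᵖ` with `‖v(t)‖_p ≤ B` for all `t ∈ [a, b]` — on
`[a, b)` by finitely many local steps (`oseenWindow_memLp_eLpNorm_le_two_pow`), at `t = b` by
Fatou along `t ↑ b` (the slices converge pointwise by the joint continuity;
`Lp.eLpNorm_lim_le_liminf_eLpNorm`). [cite: LemarieRieusset2016, §9.9 (PDF p. 260)] -/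
theorem oseenWindow_exists_forall_memLp_eLpNorm_le (hp1 : 1 ≤ p) (hp : p ≠ ∞) (hab : a < b)
    (hcont : ContinuousOn (uncurry v) (Icc a b ×ˢ univ))
    (hK : ∀ t ∈ Icc a b, ∀ x, ‖v t x‖ ≤ K)
    (hmild : ∀ s t : ℝ, a ≤ s → s < t → t ≤ b → ∀ x,
      v t x = UnboundedOperators.heatExtension (v s) (t - s) x - oseenDuhamel 1 s v v t x)
    (h3 : MemLp (v a) p volume) :
    ∃ B : ℝ≥0∞, B < ∞ ∧ ∀ t ∈ Icc a b, MemLp (v t) p volume ∧ eLpNorm (v t) p volume ≤ B := by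
  obtain ⟨T₀, hT₀, hprop⟩ := oseenWindow_memLp_eLpNorm_le_two_pow hp1 hp hcont hK hmild h3
  -- the number of steps
  obtain ⟨n, hn⟩ := exists_nat_ge ((b - a) / (T₀ / 2))
  have hn' : b - a ≤ n * (T₀ / 2) := by rwa [div_le_iff₀ (by positivity)] at hn
  set B : ℝ≥0∞ := 2 ^ n * eLpNorm (v a) p volume with hB
  have hBtop : B < ∞ := ENNReal.mul_lt_top (ENNReal.pow_lt_top ENNReal.ofNat_lt_top) h3.eLpNorm_lt_top
  have hIco : ∀ t, a ≤ t → t < b → MemLp (v t) p volume ∧ eLpNorm (v t) p volume ≤ B :=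
    fun t hat htb => hprop n t hat htb (by linarith)
  refine ⟨B, hBtop, fun t ht => ?_⟩
  rcases ht.2.lt_or_eq with htb | rfl
  · exact hIco t ht.1 htb
  · -- the endpoint: Fatou along `tₖ = b - (b - a)/(k + 2) ↑ b`
    set s : ℕ → ℝ := fun k => t - (t - a) / ((k : ℝ) + 2) with hs
    have hsa : ∀ k, a ≤ s k := fun k => by
      have h1 : (t - a) / ((k : ℝ) + 2) ≤ (t - a) / 1 :=
        div_le_div_of_nonneg_left (by linarith) one_pos (by linarith [k.cast_nonneg (α := ℝ)])
      rw [hs]; dsimp only; linarith [div_one (t - a)]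
    have hsb : ∀ k, s k < t := fun k => by
      have h1 : 0 < (t - a) / ((k : ℝ) + 2) := div_pos (by linarith) (by positivity)
      rw [hs]; dsimp only; linarith
    have hslim : Tendsto s atTop (𝓝 t) := by
      have h1 : Tendsto (fun k : ℕ => (t - a) / ((k : ℝ) + 2)) atTop (𝓝 0) := by
        have h2 : Tendsto (fun k : ℕ => ((k : ℝ) + 2)) atTop atTop :=
          tendsto_atTop_add_const_right _ _ tendsto_natCast_atTop_atTop
        exact (tendsto_const_nhds (x := t - a)).div_atTop h2
      have := h1.const_sub t
      rwa [sub_zero] at this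
    -- pointwise convergence of the slices, from the joint continuity
    have hptw : ∀ x, Tendsto (fun k => v (s k) x) atTop (𝓝 (v t x)) := by
      intro x
      have hct : ContinuousWithinAt (uncurry v) (Icc a t ×ˢ univ) (t, x) :=
        hcont (t, x) ⟨⟨ht.1, le_rfl⟩, mem_univ _⟩
      have hpath : Tendsto (fun k => ((s k, x) : ℝ × EuclideanSpace ℝ (Fin 3))) atTop
          (𝓝[Icc a t ×ˢ univ] (t, x)) := by
        refine tendsto_nhdsWithin_iff.2 ⟨?_, Eventually.of_forall fun k => ⟨⟨hsa k, (hsb k).le⟩, mem_univ _⟩⟩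
        exact (hslim.prodMk_nhds tendsto_const_nhds)
      exact hct.tendsto.comp hpath
    have hmeas : ∀ k, AEStronglyMeasurable (v (s k)) volume := fun k => (hIco (s k) (hsa k) (hsb k)).1.1
    have hFatou := Lp.eLpNorm_lim_le_liminf_eLpNorm (p := p) hmeas (v t)
      (Eventually.of_forall hptw)
    have hliminf : liminf (fun k => eLpNorm (v (s k)) p volume) atTop ≤ B :=
      liminf_le_of_frequently_le' (Frequently.of_forall fun k => (hIco (s k) (hsa k) (hsb k)).2)
    have hbound : eLpNorm (v t) p volume ≤ B := hFatou.trans hliminf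
    have htc : Continuous (v t) :=
      hcont.comp_continuous (f := fun x : EuclideanSpace ℝ (Fin 3) => (t, x)) (by fun_prop)
        fun _ => ⟨⟨ht.1, le_rfl⟩, mem_univ _⟩
    exact ⟨⟨htc.aestronglyMeasurable, lt_of_le_of_lt hbound hBtop⟩, hbound⟩

end Literature.Analysis.FluidPDE

end
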